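import Mathlib.Data.ZMod.Basic
import Mathlib.Algebra.BigOperators.Ring.Finset
import Mathlib.Algebra.Order.Group.Unbundled.Int
import Mathlib.Topology.Algebra.InfiniteSum.Real
import Mathlib.Topology.Algebra.InfiniteSum.Order
import Mathlib.Topology.Algebra.InfiniteSum.NatInt
import Mathlib.Analysis.Normed.Group.InfiniteSum
import Mathlib.Analysis.SpecialFunctions.Trigonometric.Basic
import Mathlib.Analysis.SpecialFunctions.Exp
import Mathlib.Analysis.SpecificLimits.Basic
import Mathlib.Analysis.SpecialFunctions.Gaussian.PoissonSummation
import Literature.Probability.LatticeModels.LatticeGraph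
import HarnessLib

/-!
# Positive closed-current ("J-current") models on space-time tori

The INTERFACE object of the abelian-duality engine (requested by route
HubbardSuperconductivity/AbelianDuality, item `defn-PositiveCurrentModel`): a `(d+1)`-dimensional
`U(1)` **closed-current model** on the space-time torus `(ℤ/Lℤ)^d × ℤ/Mℤ` (`M` = number of
imaginary-time slices), in the sense of Wallin–Sørensen–Girvin–Young, *Phys. Rev. B* **49**
(1994) 12115, §II ("J-current model"):

* configurations are integer-valued 1-forms `J` on the positively oriented bonds
  `(s, μ) : s → s + e_μ` of the space-time torus (`JCurrent.Config`), subject to the lattice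
  continuity equation `∂_ν J^ν = 0` at every site (`JCurrent.div J = 0`);
* the weight of a configuration is a product over bonds of NON-NEGATIVE, translation-invariant,
  direction-dependent local factors `w_μ(J_b) ≥ 0` (`PositiveCurrentModel.weight`,
  `PositiveCurrentModel.bondWeight`), with `w_μ` even, `w_μ(0) > 0` and `∑_n w_μ(n) < ∞`;
* `Z_{L,M} = ∑_{J : div J = 0} ∏_b w_{μ(b)}(J_b)` (`partitionFunction`), and more generally the
  current sum with prescribed sources `ρ` (`currentSum ρ = ∑_{div J = ρ} ∏_b w(J_b)`);
* the equal-time **two-point function** `G_{L,M}(x,y) = Z⁻¹ ∑_{div J = δ_{(x,0)} - δ_{(y,0)}} ∏ w`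
  (`twoPoint`; the "open worm" with one unit of current injected at `(x,0)` and removed at
  `(y,0)`), also packaged in the tree's long-range-order format
  `(L : ℕ) → TorusSite d L → TorusSite d L → ℝ` at fixed `M` (`torusTwoPoint`), and the
  ground-state long-range-order predicate `HasGroundStateLRO` (uniform in `L`, surviving
  `M → ∞`).

Over the model we provide the predicates the route asked for:

* `IsDualPositive`: every bond weight is a positive-definite function on `ℤ`, i.e. its Fourier
  series (the dual, angle-space bond Boltzmann factor) `ŵ_μ(θ) = ∑_n w_μ(n) e^{inθ} =
  ∑_n w_μ(n) cos(nθ)` (`dualWeight`) is `≥ 0`. Under this hypothesis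
  `∏_b ŵ_{μ(b)}(θ_{s+e_μ} - θ_s) ∏_s dθ_s/2π` is a genuine (non-negative) XY-type Gibbs measure
  whose correlation `⟨e^{i(θ_x-θ_y)}⟩` equals `G(x,y)` by Fourier expansion bond by bond (the
  `θ_s`-integrals enforce `div J = δ_x - δ_y`), and the model case is the Villain model
  (`villain`, weights `e^{-n²/2β_μ}`, whose dual factor is the periodised Gaussian by Poisson
  summation: Wallin et al. §II; Fröhlich–Spencer 1981/1982; Guth 1980).
* `bondStiffness μ = (∑ n² w_μ(n)) / (∑ w_μ(n))` — the curvature of the dual bond energy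
  `-log ŵ_μ` at its minimum `θ = 0` (bare spin-wave stiffness of direction `μ`; `≈ β_μ` for
  Villain weights at large `β_μ`), `vortexFugacity μ = sup_{π/2 ≤ θ ≤ π} ŵ_μ(θ)/ŵ_μ(0)` — the
  bare Boltzmann suppression of a bond twisted by at least a quarter turn (every plaquette
  carrying a vortex has such a bond), and the dilute-vortex class
  `IsVortexDilute ρ₀ z₀ : stiffness ≥ ρ₀ and fugacity ≤ z₀ in every direction`.

## What the source prints (Wallin–Sørensen–Girvin–Young 1994, §II; arXiv:cond-mat/9309035 pp. 8–10)

Starting from the quantum rotor / Josephson-junction form of the boson Hubbard model on an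
`L × L` square lattice with `M` imaginary-time slices (`Δτ = β/M`, periodic in time), "Inserting
[the Villain form] … and Fourier transforming one can carry out the `{θ}` integrations exactly.
Their effect is to enforce conservation of integer-valued currents defined by
`J = (J^x, J^y, J^τ)`. In other words, the current should be divergenceless at every site in
space and time, i.e. it should obey a continuity equation `∂_ν J^ν = 0`. If `J^x_{(x,y,τ)}` lies
on the bond between sites `(x,y,τ)` and `(x+1,y,τ)` then it is convenient to define
`J^{-x}_{(x,y,τ)} = -J^x_{(x-1,y,τ)}`, etc. The divergence constraint is then imposed at each site
by requiring that `∑_ν J^ν_{(r,τ)} = 0`, where `ν` runs over `±x, ±y, ±τ`. We thus obtain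
`Z ≈ ∑'_{J} exp{-½ ∑_{(r,τ)} ∑_{ν=x,y,τ} K̃_ν (J^ν_{(r,τ)})²}`, where the sum is over all integer
values of the `J^ν` from `-∞` to `∞`, the prime indicates the constraint that `J` be everywhere
divergenceless, and the couplings are `K̃_τ = U Δτ` and `K̃_y = K̃_x = ½ ln(2/K_x)`" …
"We interpret `J^ν` as the 'relativistic' 3-vector current with `(J^x, J^y)` being the spatial
current and `J^τ` being the particle density" … "it can be thought of as an imaginary time
'world-line' path-integral representation of the problem"; and the Poisson identity
`∑_J e^{-Δτ U J²/2} e^{iJθ} = ∑_m √(2π/ΔτU) e^{-(θ-2πm)²/(2ΔτU)}`, "the Villain approximation".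
The bond-factorised Gaussian weights `exp{-½ K̃_ν J²}` are `villain β` with `β_ν = 1/K̃_ν`.

## Design choices and flags (read before building statements on this file)

* Generality: spatial dimension `d` is a parameter (the route uses `d = 2`); weights depend on
  the bond direction `μ : JCurrent.Dir d = Option (Fin d)` (`some i` = spatial direction `i`,
  `none` = imaginary time), which covers the requested `w_space`, `w_time`. Only the
  BOND-FACTORISED, EVEN (particle–hole symmetric, `J ↦ -J`), zero-chemical-potential case is
  here, as in the request's "minimal version"; finite-range multi-bond factors, chemical
  potential / non-integer density (Wallin et al. eq. with `-Δτ(μ+v_r)J^τ`, complex or non-even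
  weights) and continuum imaginary time are deliberately NOT here.
* All sums over configurations are `tsum`s over the countable type `JCurrent.Config d L M` of
  an indicator times the weight (the convention of `RandomCurrents.currentSum`); summability is
  proved (`summable_bondWeight`, product of summable non-negative bond factors), so
  `0 < Z < ∞` (`partitionFunction_pos`) and `G(x,x) = 1`, `G ≥ 0`, `G(x,y) = G(y,x)` are theorems.
  Finite tori need `[NeZero L] [NeZero M]`; the LRO-format family `torusTwoPoint` takes the junk
  value `0` at `L = 0` (immaterial for `liminf_{L → ∞}` statements such as
  `Literature.MathematicalPhysics.QuantumLattice.HasTorusLRO`).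
* `HasGroundStateLRO P m` quantifies `∀ L ≥ L₀, ∃ M₀, ∀ M ≥ M₀`: the bound `m L^{2d} ≤ ∑_{x,y} G`
  is uniform in `L` and holds for all sufficiently long imaginary time. It is NOT required
  uniformly in `M ≥ 1`: at fixed `M` the space-time torus is a slab of thickness `M`, i.e. a
  `d`-dimensional system, and for `d = 2` a dual-positive model at fixed `M` is a two-dimensional
  XY-type model without long-range order (Mermin–Wagner; cf. the tree's barrier
  `Literature.Barriers.HubbardSuperconductivity.PositiveTemperatureNoPairLRO`). Statements that
  need another order of quantifiers should be written directly with `twoPoint`.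
* `bondStiffness`, `vortexFugacity`, `IsVortexDilute` are BARE single-bond functionals chosen
  here (design choice of this file, tagged folklore): they are read off the dual bond factor
  `ŵ_μ` alone and need no Villain decomposition data. Whether "dual-positive, stiffness `≥ ρ₀`,
  fugacity `≤ z₀(ρ₀)`" implies `HasGroundStateLRO` (the route's intended ENGINE CLASS THEOREM,
  an energy–entropy argument on vortex loops of the dual integer gauge / height model, Guth 1980,
  Fröhlich–Spencer 1982) is NOT claimed here. Caveat for time-continuum limits: along Wallin et
  al.'s family `β_space = 1/K̃_x = 2/ln(2/(tΔτ)) → 0`, `β_time = 1/(UΔτ) → ∞` as `Δτ → 0`, so a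
  direction-uniform stiffness threshold is not uniform in `Δτ`; an anisotropy-rescaled variant
  may be needed for that limit.
* Mathlib / tree search: Mathlib has no lattice current models (`rg` for `divergence-free`,
  `closed current`, `Villain`: nothing relevant); the tree has Ising random currents
  (`RandomCurrents`, `ℕ`-valued, sources = odd degree — a different object), the Villain angle
  kernel `Literature.MathematicalPhysics.QuantumFieldTheory.villainKernel` and the `d = 4` gauge
  analogue `zdVillainWeight` (free boundary, `U(1)`-valued fields). Reused: `TorusSite`.

## References

* M. Wallin, E. S. Sørensen, S. M. Girvin, A. P. Young, *Superconductor–insulator transition in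
  two-dimensional dirty boson systems*, Phys. Rev. B 49 (1994) 12115–12139, §II. [WallinEtAl1994]
* J. Fröhlich, T. Spencer, Comm. Math. Phys. 83 (1982) 411–454, §2 (Villain action (2.2)–(2.3),
  duality); Comm. Math. Phys. 81 (1981) 527–602. [FrohlichSpencerCMP1982, FrohlichSpencerKT1981]
* A. H. Guth, Phys. Rev. D 21 (1980) 2291–2307. [Guth1980]
* M. P. A. Fisher, D. H. Lee, Phys. Rev. B 39 (1989) 2756–2759. [FisherLee1989]
-/

noncomputable section

open Finset Filter

namespace Literature.Probability.LatticeModels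

/-! ### A summability lemma: products of summable non-negative factors over a finite index set -/

/-- `∑_{k : ι → ℤ} ∏ᵢ aᵢ(kᵢ) < ∞` when every `aᵢ ≥ 0` is summable (`ι` finite); indeed every finite
partial sum is bounded by `∏ᵢ ∑_n aᵢ(n)`. (Index-dependent version of
`Literature.Analysis.FunctionSpaces.Torus.summable_pi_prod_of_summable`.) [folklore] -/
theorem summable_pi_prod_of_summable' {ι : Type*} [Fintype ι] [DecidableEq ι] (a : ι → ℤ → ℝ)
    (h0 : ∀ i n, 0 ≤ a i n) (hs : ∀ i, Summable (a i)) :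
    Summable (fun k : ι → ℤ => ∏ i, a i (k i)) := by
  have hnn : ∀ k : ι → ℤ, 0 ≤ ∏ i, a i (k i) := fun k => Finset.prod_nonneg fun i _ => h0 i _
  refine summable_of_sum_le hnn (c := ∏ i, ∑' n, a i n) fun u => ?_
  set T : ι → Finset ℤ := fun i => u.image fun k => k i with hT
  have hsub : u ⊆ Fintype.piFinset T := fun k hk =>
    Fintype.mem_piFinset.2 fun i => Finset.mem_image_of_mem (fun k => k i) hk
  calc ∑ k ∈ u, ∏ i, a i (k i) ≤ ∑ k ∈ Fintype.piFinset T, ∏ i, a i (k i) :=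
        Finset.sum_le_sum_of_subset_of_nonneg hsub fun k _ _ => hnn k
    _ = ∏ i, ∑ n ∈ T i, a i n := (Finset.prod_univ_sum T fun i n => a i n).symm
    _ ≤ ∏ i, ∑' n, a i n :=
        Finset.prod_le_prod (fun i _ => Finset.sum_nonneg fun n _ => h0 i n)
          fun i _ => (hs i).sum_le_tsum (T i) fun n _ => h0 i n

/-! ### Space-time tori, oriented bonds, integer currents and their divergence -/

namespace JCurrent

/-- A site `(r, τ)` of the space-time torus `(ℤ/Lℤ)^d × ℤ/Mℤ`: spatial position
`r : TorusSite d L` and imaginary-time slice `τ : ZMod M` (Wallin et al. 1994, §II: `L × L`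
square lattice, `M` time slices, periodic boundary conditions in space and time).
[cite: WallinEtAl1994, §II] -/
abbrev SpaceTimeSite (d L M : ℕ) : Type := TorusSite d L × ZMod M

/-- Lattice directions of the `(d+1)`-dimensional space-time lattice: `some i` is the spatial
direction `i : Fin d`, `none` is the imaginary-time direction `τ` (Wallin et al. 1994, §II,
`ν = x, y, τ`). [cite: WallinEtAl1994, §II] -/
abbrev Dir (d : ℕ) : Type := Option (Fin d)

/-- Positively oriented bonds of the space-time torus: `(s, μ)` is the bond from `s` to
`s + e_μ` (Wallin et al. 1994, §II: "`J^x_{(x,y,τ)}` lies on the bond between sites `(x,y,τ)` and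
`(x+1,y,τ)`"). [cite: WallinEtAl1994, §II] -/
abbrev Bond (d L M : ℕ) : Type := SpaceTimeSite d L M × Dir d

/-- Current configurations: integer-valued 1-forms `J` on the oriented bonds, `J (s, μ) ∈ ℤ`
being the current flowing from `s` to `s + e_μ` (negative values flow backwards;
Wallin et al. 1994, §II, `J = (J^x, J^y, J^τ)`, "all integer values of the `J^ν` from `-∞` to
`∞`"). [cite: WallinEtAl1994, §II] -/
abbrev Config (d L M : ℕ) : Type := Bond d L M → ℤ

variable {d L M : ℕ}

/-- The unit lattice vector `e_μ` of direction `μ` in the space-time torus: `e_{some i}` is the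
spatial unit vector `eᵢ`, `e_none = (0, 1)` is one imaginary-time step. [cite: WallinEtAl1994, §II] -/
def unitVec : Dir d → SpaceTimeSite d L M
  | none => (0, 1)
  | some i => (Pi.single i 1, 0)

/-- The lattice divergence of a current configuration at a site,
`(div J)(s) = ∑_μ (J(s, μ) - J(s - e_μ, μ))` = outflow minus inflow (Wallin et al. 1994, §II:
"`∑_ν J^ν_{(r,τ)}` where `ν` runs over `±x, ±y, ±τ`", with `J^{-x}_{(x,y,τ)} = -J^x_{(x-1,y,τ)}`).
[cite: WallinEtAl1994, §II] -/
def div (J : Config d L M) (s : SpaceTimeSite d L M) : ℤ :=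
  ∑ μ : Dir d, (J (s, μ) - J (s - unitVec μ, μ))

/-- The zero current is divergence free. [folklore] -/
@[simp] theorem div_zero : div (0 : Config d L M) = 0 := by
  funext s
  simp [div]

/-- Reversing all currents reverses the divergence: `div (-J) = -div J`. [folklore] -/
@[simp] theorem div_neg (J : Config d L M) : div (-J) = -div J := by
  funext s
  simp only [div, Pi.neg_apply]
  rw [← Finset.sum_neg_distrib]
  refine Finset.sum_congr rfl fun μ _ => ?_
  ring

/-- The divergence is additive: `div (J₁ + J₂) = div J₁ + div J₂`. [folklore] -/
theorem div_add (J₁ J₂ : Config d L M) : div (J₁ + J₂) = div J₁ + div J₂ := by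
  funext s
  simp only [div, Pi.add_apply, ← Finset.sum_add_distrib]
  refine Finset.sum_congr rfl fun μ _ => ?_
  ring

/-- The source function of the equal-time "open worm" from `x` to `y`: `+1` at `(x, 0)`, `-1` at
`(y, 0)` (zero if `x = y`). [folklore] -/
def wormSource (x y : TorusSite d L) : SpaceTimeSite d L M → ℤ :=
  Pi.single ((x, 0) : SpaceTimeSite d L M) 1 - Pi.single ((y, 0) : SpaceTimeSite d L M) 1

/-- `wormSource x x = 0`. [folklore] -/
@[simp] theorem wormSource_self (x : TorusSite d L) : (wormSource x x : SpaceTimeSite d L M → ℤ) = 0 :=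
  sub_self _

/-- `wormSource y x = -wormSource x y`. [folklore] -/
theorem wormSource_swap (x y : TorusSite d L) :
    (wormSource y x : SpaceTimeSite d L M → ℤ) = -wormSource x y :=
  (neg_sub _ _).symm

end JCurrent

open JCurrent

/-! ### The model: non-negative, even, summable bond weights -/

/-- A **positive closed-current (J-current) model** in `d + 1` dimensions with bond-factorised,
translation-invariant weights: for every lattice direction `μ` (`d` spatial ones and imaginary
time) an even weight function `w_μ : ℤ → ℝ` with `w_μ(n) ≥ 0`, `w_μ(0) > 0` and `∑_n w_μ(n) < ∞`.
On the space-time torus `(ℤ/Lℤ)^d × ℤ/Mℤ` the model gives the divergence-free integer current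
configuration `J` the weight `∏_b w_{μ(b)}(J_b)` (Wallin et al. 1994, §II, where
`w_ν(J) = exp{-½ K̃_ν J²}`, i.e. `villain` below; general non-negative local factors are the
interface requested by route HubbardSuperconductivity/AbelianDuality). Evenness is the
`J ↦ -J` (particle–hole) symmetry of the zero-chemical-potential model.
[cite: WallinEtAl1994, §II] -/
structure PositiveCurrentModel (d : ℕ) where
  /-- The weight `w_μ(n)` of a bond of direction `μ` carrying current `n`. -/
  weight : Dir d → ℤ → ℝ
  /-- Weights are non-negative. -/
  weight_nonneg : ∀ μ n, 0 ≤ weight μ n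
  /-- Weights are even in the current (`J ↦ -J` symmetry). -/
  weight_neg : ∀ μ n, weight μ (-n) = weight μ n
  /-- The empty bond has positive weight. -/
  weight_zero_pos : ∀ μ, 0 < weight μ 0
  /-- `∑_n w_μ(n) < ∞`. -/
  summable_weight : ∀ μ, Summable (weight μ)

namespace PositiveCurrentModel

variable {d : ℕ} (P : PositiveCurrentModel d)

/-! ### Finite-volume weights, current sums, partition function, two-point function -/

section FiniteVolume

variable {L M : ℕ} [NeZero L] [NeZero M]

/-- The Boltzmann weight of a current configuration, `W(J) = ∏_b w_{μ(b)}(J_b)` (product over all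
positively oriented bonds of the space-time torus; Wallin et al. 1994, §II,
`exp{-½ ∑_{(r,τ)} ∑_ν K̃_ν (J^ν_{(r,τ)})²}`). [cite: WallinEtAl1994, §II] -/
def bondWeight (J : Config d L M) : ℝ := ∏ b, P.weight b.2 (J b)

/-- `W(J) ≥ 0`. [folklore] -/
theorem bondWeight_nonneg (J : Config d L M) : 0 ≤ P.bondWeight J :=
  Finset.prod_nonneg fun b _ => P.weight_nonneg b.2 (J b)

/-- The empty configuration has positive weight `∏_b w_{μ(b)}(0) > 0`. [folklore] -/
theorem bondWeight_zero_pos : 0 < P.bondWeight (0 : Config d L M) :=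
  Finset.prod_pos fun b _ => by simpa using P.weight_zero_pos b.2

/-- `W(-J) = W(J)` (evenness of the weights). [folklore] -/
theorem bondWeight_neg (J : Config d L M) : P.bondWeight (-J) = P.bondWeight J := by
  simp only [bondWeight, Pi.neg_apply, P.weight_neg]

/-- `∑_J W(J) < ∞` over ALL integer current configurations of the finite space-time torus
(product of summable non-negative bond factors). [folklore] -/
theorem summable_bondWeight : Summable (fun J : Config d L M => P.bondWeight J) :=
  summable_pi_prod_of_summable' (fun b : Bond d L M => P.weight b.2)
    (fun b n => P.weight_nonneg b.2 n) fun b => P.summable_weight b.2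

/-- The **current sum with prescribed sources** `ρ`:
`∑_{J : div J = ρ} ∏_b w_{μ(b)}(J_b)`, as a `tsum` of the indicator times the weight over all
configurations (zero if no configuration has divergence `ρ`, e.g. if `∑_s ρ(s) ≠ 0`).
(Wallin et al. 1994, §II: the primed sum `∑'_{J}` "indicates the constraint that `J` be
everywhere divergenceless", here with a general right-hand side.) [cite: WallinEtAl1994, §II] -/
def currentSum (ρ : SpaceTimeSite d L M → ℤ) : ℝ :=
  ∑' J : Config d L M, if div J = ρ then P.bondWeight J else 0

/-- The summand of `currentSum` is non-negative. [folklore] -/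
theorem currentSummand_nonneg (ρ : SpaceTimeSite d L M → ℤ) (J : Config d L M) :
    0 ≤ (if div J = ρ then P.bondWeight J else 0) := by
  split_ifs
  · exact P.bondWeight_nonneg J
  · exact le_rfl

/-- The summand of `currentSum` is summable (dominated by `W`). [folklore] -/
theorem summable_currentSummand (ρ : SpaceTimeSite d L M → ℤ) :
    Summable (fun J : Config d L M => if div J = ρ then P.bondWeight J else 0) := by
  refine Summable.of_nonneg_of_le (P.currentSummand_nonneg ρ) (fun J => ?_) P.summable_bondWeight
  split_ifs
  · exact le_rfl
  · exact P.bondWeight_nonneg J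

/-- `currentSum ρ ≥ 0`. [folklore] -/
theorem currentSum_nonneg (ρ : SpaceTimeSite d L M → ℤ) : 0 ≤ P.currentSum ρ :=
  tsum_nonneg (P.currentSummand_nonneg ρ)

/-- Reversing the sources does not change the current sum: `∑_{div J = -ρ} W = ∑_{div J = ρ} W`
(substitute `J ↦ -J` and use evenness). [folklore] -/
theorem currentSum_neg (ρ : SpaceTimeSite d L M → ℤ) : P.currentSum (-ρ) = P.currentSum ρ := by
  unfold currentSum
  conv_lhs => rw [← (Equiv.neg (Config d L M)).tsum_eq]
  refine tsum_congr fun J => ?_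
  simp only [Equiv.neg_apply, div_neg, neg_inj, bondWeight_neg]

/-- The **partition function** `Z_{L,M} = ∑_{J : div J = 0} ∏_b w_{μ(b)}(J_b)` of the closed-current
model on `(ℤ/Lℤ)^d × ℤ/Mℤ` (Wallin et al. 1994, §II). [cite: WallinEtAl1994, §II] -/
def partitionFunction (L M : ℕ) [NeZero L] [NeZero M] : ℝ :=
  P.currentSum (0 : SpaceTimeSite d L M → ℤ)

/-- `0 < Z_{L,M}` (the empty configuration contributes `∏_b w(0) > 0`, and the sum converges).
[folklore] -/
theorem partitionFunction_pos (L M : ℕ) [NeZero L] [NeZero M] : 0 < P.partitionFunction L M := by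
  unfold partitionFunction currentSum
  refine (P.summable_currentSummand 0).tsum_pos (P.currentSummand_nonneg 0) 0 ?_
  simp only [div_zero, ↓reduceIte]
  exact P.bondWeight_zero_pos

/-- The equal-time **two-point function** ("open worm")
`G_{L,M}(x, y) = Z⁻¹ ∑_{J : div J = δ_{(x,0)} - δ_{(y,0)}} ∏_b w_{μ(b)}(J_b)`: one unit of current
is injected at `(x, 0)` and extracted at `(y, 0)`. When the weights are dual-positive this is the
spin–spin correlation `⟨e^{i(θ_x - θ_y)}⟩ = ⟨cos(θ_x - θ_y)⟩` of the dual XY-type model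
`∏_b ŵ(∇_b θ) ∏ dθ/2π` (Fourier-expand every bond factor; the `θ`-integrals enforce the
divergence condition — Wallin et al. 1994, §II, "Fourier transforming one can carry out the
`{θ}` integrations exactly. Their effect is to enforce conservation of integer-valued currents").
[cite: WallinEtAl1994, §II] -/
def twoPoint (L M : ℕ) [NeZero L] [NeZero M] (x y : TorusSite d L) : ℝ :=
  P.currentSum (wormSource x y : SpaceTimeSite d L M → ℤ) / P.partitionFunction L M

/-- `G(x, y) ≥ 0`. [folklore] -/
theorem twoPoint_nonneg (L M : ℕ) [NeZero L] [NeZero M] (x y : TorusSite d L) :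
    0 ≤ P.twoPoint L M x y :=
  div_nonneg (P.currentSum_nonneg _) (P.partitionFunction_pos L M).le

/-- `G(x, x) = 1`. [folklore] -/
@[simp] theorem twoPoint_self (L M : ℕ) [NeZero L] [NeZero M] (x : TorusSite d L) :
    P.twoPoint L M x x = 1 := by
  unfold twoPoint
  rw [wormSource_self]
  exact div_self (P.partitionFunction_pos L M).ne'

/-- `G(x, y) = G(y, x)` (by the `J ↦ -J` symmetry). [folklore] -/
theorem twoPoint_comm (L M : ℕ) [NeZero L] [NeZero M] (x y : TorusSite d L) :
    P.twoPoint L M x y = P.twoPoint L M y x := by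
  unfold twoPoint
  rw [wormSource_swap x y, currentSum_neg]

end FiniteVolume

/-! ### Long-range order of the two-point function -/

/-- The two-point function at fixed imaginary-time extent `M` in the tree's long-range-order
format `(L : ℕ) → TorusSite d L → TorusSite d L → ℝ` (the argument type of
`Literature.MathematicalPhysics.QuantumLattice.HasTorusLRO`); junk value `0` at `L = 0`.
[folklore] -/
def torusTwoPoint (M : ℕ) [NeZero M] : (L : ℕ) → TorusSite d L → TorusSite d L → ℝ :=
  fun L => if hL : L = 0 then fun _ _ => 0 else
    haveI : NeZero L := ⟨hL⟩
    P.twoPoint L M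

/-- `torusTwoPoint` agrees with `twoPoint` on non-degenerate tori. [folklore] -/
theorem torusTwoPoint_eq (M L : ℕ) [NeZero M] [hL : NeZero L] (x y : TorusSite d L) :
    P.torusTwoPoint M L x y = P.twoPoint L M x y := by
  unfold torusTwoPoint
  rw [dif_neg hL.ne]

/-- **Ground-state long-range order with density `m`**: for all large `L` and then all
sufficiently long imaginary time `M ≥ M₀(L)`, `m · L^{2d} ≤ ∑_{x,y ∈ (ℤ/Lℤ)^d} G_{L,M}(x, y)`
— uniform in `L`, surviving `M → ∞` (zero temperature at fixed volume). Not demanded uniformly in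
`M ≥ 1` (thin slabs are `d`-dimensional; see the module docstring). [folklore] -/
def HasGroundStateLRO (m : ℝ) : Prop :=
  ∃ L₀ : ℕ, ∀ (L : ℕ) [NeZero L], L₀ ≤ L → ∃ M₀ : ℕ, ∀ (M : ℕ) [NeZero M], M₀ ≤ M →
    m * (L : ℝ) ^ (2 * d) ≤ ∑ x : TorusSite d L, ∑ y : TorusSite d L, P.twoPoint L M x y

/-! ### Dual (angle-space) bond factors and dual positivity -/

/-- The **dual bond Boltzmann factor** `ŵ_μ(θ) = ∑_n w_μ(n) cos(nθ)` of direction `μ`, i.e. the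
Fourier series `∑_n w_μ(n) e^{inθ}` of the (even, summable) weight sequence — the angle-space
factor whose bond-by-bond Fourier expansion gives back the current model. For Villain weights
it is the periodised Gaussian `∑_m √(2πβ) e^{-β(θ - 2πm)²/2}` (Poisson summation; Wallin et al.
1994, §II, "This periodic sequence of narrow Gaussians is the Villain approximation").
[cite: WallinEtAl1994, §II] -/
def dualWeight (μ : Dir d) (θ : ℝ) : ℝ := ∑' n : ℤ, P.weight μ n * Real.cos (n * θ)

/-- `‖w_μ(n) cos(nθ)‖ ≤ w_μ(n)`. [folklore] -/
theorem norm_weight_mul_cos_le (μ : Dir d) (θ : ℝ) (n : ℤ) :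
    ‖P.weight μ n * Real.cos (n * θ)‖ ≤ P.weight μ n := by
  rw [Real.norm_eq_abs, abs_mul, abs_of_nonneg (P.weight_nonneg μ n)]
  exact mul_le_of_le_one_right (P.weight_nonneg μ n) (Real.abs_cos_le_one _)

/-- The series defining `ŵ_μ(θ)` converges absolutely. [folklore] -/
theorem summable_norm_weight_mul_cos (μ : Dir d) (θ : ℝ) :
    Summable (fun n : ℤ => ‖P.weight μ n * Real.cos (n * θ)‖) :=
  Summable.of_nonneg_of_le (fun _ => norm_nonneg _) (P.norm_weight_mul_cos_le μ θ)
    (P.summable_weight μ)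

/-- The series defining `ŵ_μ(θ)` converges. [folklore] -/
theorem summable_weight_mul_cos (μ : Dir d) (θ : ℝ) :
    Summable (fun n : ℤ => P.weight μ n * Real.cos (n * θ)) :=
  (P.summable_norm_weight_mul_cos μ θ).of_norm

/-- `ŵ_μ(0) = ∑_n w_μ(n)`. [folklore] -/
theorem dualWeight_zero (μ : Dir d) : P.dualWeight μ 0 = ∑' n : ℤ, P.weight μ n := by
  simp [dualWeight]

/-- `ŵ_μ(0) > 0`. [folklore] -/
theorem dualWeight_zero_pos (μ : Dir d) : 0 < P.dualWeight μ 0 := by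
  rw [dualWeight_zero]
  exact (P.summable_weight μ).tsum_pos (P.weight_nonneg μ) 0 (P.weight_zero_pos μ)

/-- `ŵ_μ` is even in `θ`. [folklore] -/
theorem dualWeight_neg (μ : Dir d) (θ : ℝ) : P.dualWeight μ (-θ) = P.dualWeight μ θ := by
  simp [dualWeight, Real.cos_neg]

/-- `|ŵ_μ(θ)| ≤ ŵ_μ(0)`: positivity of the current weights bounds the dual factor by its value at
the aligned angle. [folklore] -/
theorem abs_dualWeight_le (μ : Dir d) (θ : ℝ) : |P.dualWeight μ θ| ≤ P.dualWeight μ 0 := by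
  rw [dualWeight_zero, dualWeight]
  have h1 := P.summable_norm_weight_mul_cos μ θ
  refine (Real.norm_eq_abs _ ▸ norm_tsum_le_tsum_norm h1).trans ?_
  exact h1.tsum_le_tsum (P.norm_weight_mul_cos_le μ θ) (P.summable_weight μ)

/-- **Dual positivity**: every bond weight `w_μ` is a positive-definite function on `ℤ`, i.e.
(Herglotz/Bochner, for summable even `w_μ`) its Fourier series is pointwise non-negative,
`ŵ_μ(θ) = ∑_n w_μ(n) e^{inθ} ≥ 0` for all `θ`. Then `Z⁻¹ ∏_b ŵ_{μ(b)}(θ_{s+e_μ} - θ_s) ∏_s dθ_s/2π`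
is a probability measure on angle configurations (the dual XY / Villain-type model) with
`⟨cos(θ_x - θ_y)⟩ = G(x,y)`, the starting point of the duality current model ↔ integer
gauge/height model ↔ vortex-loop gas with non-negative weights (Fröhlich–Spencer 1982 §2;
Guth 1980). The Villain weights `e^{-n²/2β}` are the model case (their dual factor is a sum of
Gaussians; Wallin et al. 1994, §II). [cite: WallinEtAl1994, §II] -/
def IsDualPositive (P : PositiveCurrentModel d) : Prop := ∀ (μ : Dir d) (θ : ℝ), 0 ≤ P.dualWeight μ θ

/-! ### Bare stiffness, bare vortex fugacity, the dilute-vortex class -/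

/-- The **bare stiffness** of direction `μ`: `(∑_n n² w_μ(n)) / (∑_n w_μ(n))`, the second moment
of the normalised single-bond current distribution, equivalently the curvature at `θ = 0` of
the dual bond energy `-log ŵ_μ(θ)` (`ŵ_μ'(0) = 0`, `-ŵ_μ''(0)/ŵ_μ(0) = ∑ n² w / ∑ w`). For Villain
weights `e^{-n²/2β}` with `β` large it is `β (1 + o(1))`. Junk value: if `∑ n² w_μ(n) = ∞` the
`tsum` is `0` and the stiffness reads `0`. (Design choice of this file.) [folklore] -/
def bondStiffness (μ : Dir d) : ℝ :=
  (∑' n : ℤ, (n : ℝ) ^ 2 * P.weight μ n) / ∑' n : ℤ, P.weight μ n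

/-- The **bare vortex fugacity** of direction `μ`: `sup_{π/2 ≤ θ ≤ π} ŵ_μ(θ) / ŵ_μ(0) ∈ [-1, 1]`,
the relative dual Boltzmann factor of a bond twisted by at least a quarter turn. A plaquette
carrying vorticity (`∑` of its four bond angle differences, reduced to `(-π, π]`, equal to `±2π`)
has a bond with `|∇θ| ≥ π/2`, so this is the bare activity per vortex plaquette entering an
energy–entropy (Peierls) estimate on vortex lines. For Villain weights it is `O(e^{-π²β/8})`.
(Design choice of this file.) [folklore] -/
def vortexFugacity (μ : Dir d) : ℝ :=
  ⨆ θ : Set.Icc (Real.pi / 2) Real.pi, P.dualWeight μ θ / P.dualWeight μ 0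

/-- The **dilute-vortex class** with thresholds `ρ₀`, `z₀`: in every lattice direction the bare
stiffness is at least `ρ₀` and the dual factor of every bond twisted by `θ ∈ [π/2, π]` is at most
`z₀` times its aligned value (i.e. `vortexFugacity μ ≤ z₀`; by evenness of `ŵ_μ` this covers
`θ ∈ [-π, -π/2]` too). The route's intended engine theorem reads
`∀ ρ₀ > 0, ∃ z₀ > 0, ∃ m > 0, ∀ P, P.IsDualPositive → P.IsVortexDilute ρ₀ z₀ → P.HasGroundStateLRO m`
(NOT claimed here). (Design choice of this file.) [folklore] -/
def IsVortexDilute (ρ₀ z₀ : ℝ) : Prop :=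
  ∀ μ : Dir d, ρ₀ ≤ P.bondStiffness μ ∧
    ∀ θ ∈ Set.Icc (Real.pi / 2) Real.pi, P.dualWeight μ θ ≤ z₀ * P.dualWeight μ 0

/-- The fugacity clause of `IsVortexDilute` is `vortexFugacity μ ≤ z₀`. [folklore] -/
theorem vortexFugacity_le_iff (μ : Dir d) (z₀ : ℝ) :
    P.vortexFugacity μ ≤ z₀ ↔
      ∀ θ ∈ Set.Icc (Real.pi / 2) Real.pi, P.dualWeight μ θ ≤ z₀ * P.dualWeight μ 0 := by
  have hpos := P.dualWeight_zero_pos μ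
  have hne : Nonempty (Set.Icc (Real.pi / 2) Real.pi) :=
    ⟨⟨Real.pi, ⟨by linarith [Real.pi_pos], le_rfl⟩⟩⟩
  have hbdd : BddAbove (Set.range fun θ : Set.Icc (Real.pi / 2) Real.pi =>
      P.dualWeight μ θ / P.dualWeight μ 0) := by
    refine ⟨1, ?_⟩
    rintro _ ⟨θ, rfl⟩
    rw [div_le_one hpos]
    exact (le_abs_self _).trans (P.abs_dualWeight_le μ θ)
  rw [vortexFugacity, ciSup_le_iff hbdd]
  constructor
  · intro h θ hθ
    have := h ⟨θ, hθ⟩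
    rwa [div_le_iff₀ hpos] at this
  · intro h θ
    rw [div_le_iff₀ hpos]
    exact h θ θ.2

/-! ### The Villain model -/

/-- The **Villain current weight** `e^{-n²/(2β)}` of inverse stiffness `1/β` — the bond factor
`exp{-½ K̃_ν J²}` of Wallin et al. 1994, §II with `β = 1/K̃_ν`; by Poisson summation its dual
factor is the periodised Gaussian `∑_m √(2πβ) e^{-β(θ-2πm)²/2}`, the Villain action
(Fröhlich–Spencer 1982, (2.2)). [cite: WallinEtAl1994, §II] -/
def villainCurrentWeight (β : ℝ) (n : ℤ) : ℝ := Real.exp (-(n : ℝ) ^ 2 / (2 * β))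

/-- `e^{-n²/(2β)} > 0`. [folklore] -/
theorem villainCurrentWeight_pos (β : ℝ) (n : ℤ) : 0 < villainCurrentWeight β n := Real.exp_pos _

/-- `e^{-0²/(2β)} = 1`. [folklore] -/
@[simp] theorem villainCurrentWeight_zero (β : ℝ) : villainCurrentWeight β 0 = 1 := by
  simp [villainCurrentWeight]

/-- The Villain weight is even in `n`. [folklore] -/
theorem villainCurrentWeight_neg (β : ℝ) (n : ℤ) :
    villainCurrentWeight β (-n) = villainCurrentWeight β n := by
  simp [villainCurrentWeight]

/-- `∑_n e^{-n²/(2β)} < ∞` for `β > 0` (comparison with the geometric series `e^{-|n|/(2β)}`,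
using `|n| ≤ n²` on `ℤ`). [folklore] -/
theorem summable_villainCurrentWeight {β : ℝ} (hβ : 0 < β) : Summable (villainCurrentWeight β) := by
  set r : ℝ := Real.exp (-(1 / (2 * β))) with hr_def
  have hr0 : 0 ≤ r := (Real.exp_pos _).le
  have hr1 : r < 1 := Real.exp_lt_one_iff.2 (by
    have : 0 < 1 / (2 * β) := by positivity
    linarith)
  have hg : Summable fun n : ℕ => r ^ n := summable_geometric_of_lt_one hr0 hr1
  have key : ∀ n : ℤ, villainCurrentWeight β n ≤ r ^ n.natAbs := by
    intro n
    rw [hr_def, ← Real.exp_nat_mul, villainCurrentWeight, Real.exp_le_exp]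
    have h1 : (n.natAbs : ℝ) ≤ (n : ℝ) ^ 2 := by
      have h : ((n.natAbs : ℤ) : ℝ) ≤ ((n ^ 2 : ℤ) : ℝ) := Int.cast_le.2 (Int.natAbs_le_self_sq n)
      rwa [Int.cast_natCast, Int.cast_pow] at h
    have h2 : 0 < 2 * β := by positivity
    rw [neg_div, div_eq_mul_one_div, mul_neg, neg_le_neg_iff]
    exact mul_le_mul_of_nonneg_right h1 (by positivity)
  refine Summable.of_nonneg_of_le (fun n => (villainCurrentWeight_pos β n).le) key ?_
  refine Summable.of_nat_of_neg ?_ ?_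
  · simpa using hg
  · simpa [Int.natAbs_neg] using hg

/-- The **Villain model** with direction-dependent stiffnesses `β_μ > 0`: weights
`w_μ(n) = e^{-n²/(2β_μ)}`. With `d = 2`, `β_{some _} = 1/K̃_x = 2/ln(2/(tΔτ))` and
`β_none = 1/K̃_τ = 1/(UΔτ)` this is exactly the current representation of the `(2+1)`-dimensional
quantum rotor model of Wallin et al. 1994, §II. [cite: WallinEtAl1994, §II] -/
def villain (β : Dir d → ℝ) (hβ : ∀ μ, 0 < β μ) : PositiveCurrentModel d where
  weight μ := villainCurrentWeight (β μ)
  weight_nonneg μ n := (villainCurrentWeight_pos (β μ) n).le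
  weight_neg μ n := villainCurrentWeight_neg (β μ) n
  weight_zero_pos μ := by simp
  summable_weight μ := summable_villainCurrentWeight (hβ μ)

/-- The weights of `villain β` unfolded. [folklore] -/
@[simp] theorem villain_weight (β : Dir d → ℝ) (hβ : ∀ μ, 0 < β μ) (μ : Dir d) (n : ℤ) :
    (villain β hβ).weight μ n = Real.exp (-(n : ℝ) ^ 2 / (2 * β μ)) := rfl

/-! ### The Villain model is dual-positive (Poisson summation) -/

/-- **Poisson summation for the Villain weights**: for `β > 0` and every `θ`,
`0 ≤ ∑_n e^{-n²/(2β)} cos(nθ)`; indeed the sum equals the periodised Gaussian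
`√(2πβ) ∑_m e^{-2π²β (m - θ/2π)²} = √(2πβ) ∑_m e^{-β(θ - 2πm)²/2}` ("This periodic sequence of
narrow Gaussians is the Villain approximation", Wallin et al. 1994, §II), obtained here from
Mathlib's Jacobi/Poisson transformation formula `Complex.tsum_exp_neg_quadratic` with
`a = 1/(2πβ)`, `b = iθ/2π`. [cite: WallinEtAl1994, §II] -/
theorem tsum_villainCurrentWeight_mul_cos_nonneg {β : ℝ} (hβ : 0 < β) (θ : ℝ) :
    0 ≤ ∑' n : ℤ, villainCurrentWeight β n * Real.cos (n * θ) := by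
  have hπ := Real.pi_pos
  have ha_pos : 0 < 1 / (2 * Real.pi * β) := by positivity
  have hπ' : (Real.pi : ℂ) ≠ 0 := Complex.ofReal_ne_zero.2 hπ.ne'
  have hβ' : ((β : ℝ) : ℂ) ≠ 0 := Complex.ofReal_ne_zero.2 hβ.ne'
  set a : ℂ := ((1 / (2 * Real.pi * β) : ℝ) : ℂ) with ha_def
  have ha : 0 < a.re := by rw [ha_def, Complex.ofReal_re]; exact ha_pos
  set b : ℂ := Complex.I * ((θ / (2 * Real.pi) : ℝ) : ℂ) with hb_def
  have key := Complex.tsum_exp_neg_quadratic ha b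
  -- the exponents on the left-hand side
  have hz : ∀ n : ℤ, -(Real.pi : ℂ) * a * (n : ℂ) ^ 2 + 2 * (Real.pi : ℂ) * b * n =
      ((-(n : ℝ) ^ 2 / (2 * β) : ℝ) : ℂ) + (((n : ℝ) * θ : ℝ) : ℂ) * Complex.I := by
    intro n
    rw [ha_def, hb_def]
    push_cast
    field_simp
  -- the exponents on the right-hand side are real
  have hnb : ∀ n : ℤ, (n : ℂ) + Complex.I * b = (((n : ℝ) - θ / (2 * Real.pi) : ℝ) : ℂ) := by
    intro n
    rw [hb_def, ← mul_assoc, Complex.I_mul_I]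
    push_cast
    ring
  have hw : ∀ n : ℤ, -(Real.pi : ℂ) / a * ((n : ℂ) + Complex.I * b) ^ 2 =
      ((-(2 * Real.pi ^ 2 * β) * ((n : ℝ) - θ / (2 * Real.pi)) ^ 2 : ℝ) : ℂ) := by
    intro n
    rw [hnb n, ha_def]
    push_cast
    field_simp
  -- the left-hand series: summable, with real part our series
  set f : ℤ → ℂ := fun n => Complex.exp (-(Real.pi : ℂ) * a * (n : ℂ) ^ 2 + 2 * (Real.pi : ℂ) * b * n)
    with hf_def
  have hf_re : ∀ n : ℤ, (f n).re = villainCurrentWeight β n * Real.cos (n * θ) := by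
    intro n
    rw [hf_def]
    dsimp only
    rw [hz n, Complex.exp_re]
    simp only [Complex.add_re, Complex.add_im, Complex.ofReal_re, Complex.ofReal_im, Complex.mul_re,
      Complex.mul_im, Complex.I_re, Complex.I_im, mul_zero, mul_one, zero_add, add_zero, sub_zero]
    rfl
  have hf_norm : ∀ n : ℤ, ‖f n‖ = villainCurrentWeight β n := by
    intro n
    rw [hf_def]
    dsimp only
    rw [hz n, Complex.norm_exp]
    simp only [Complex.add_re, Complex.ofReal_re, Complex.ofReal_im, Complex.mul_re, Complex.I_re,
      Complex.I_im, mul_zero, mul_one, add_zero, sub_zero]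
    rfl
  have hf_sum : Summable f := by
    refine Summable.of_norm ?_
    have : (fun n => ‖f n‖) = villainCurrentWeight β := funext hf_norm
    rw [this]
    exact summable_villainCurrentWeight hβ
  have hlhs : (∑' n : ℤ, f n).re = ∑' n : ℤ, villainCurrentWeight β n * Real.cos (n * θ) := by
    rw [Complex.re_tsum hf_sum]
    exact tsum_congr hf_re
  -- the right-hand side is a non-negative real
  have hcpow : a ^ (1 / 2 : ℂ) = (((1 / (2 * Real.pi * β)) ^ (1 / 2 : ℝ) : ℝ) : ℂ) := by
    rw [ha_def, Complex.ofReal_cpow ha_pos.le]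
    push_cast
    rfl
  set g : ℤ → ℝ := fun n => Real.exp (-(2 * Real.pi ^ 2 * β) * ((n : ℝ) - θ / (2 * Real.pi)) ^ 2)
    with hg_def
  have hterms : (fun n : ℤ => Complex.exp (-(Real.pi : ℂ) / a * ((n : ℂ) + Complex.I * b) ^ 2)) =
      fun n => ((g n : ℝ) : ℂ) := by
    funext n
    rw [hw n, ← Complex.ofReal_exp]
  have hrhs : 0 ≤ (1 / a ^ (1 / 2 : ℂ) *
      ∑' n : ℤ, Complex.exp (-(Real.pi : ℂ) / a * ((n : ℂ) + Complex.I * b) ^ 2)).re := by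
    rw [hterms, ← Complex.ofReal_tsum, hcpow, ← Complex.ofReal_one, ← Complex.ofReal_div,
      ← Complex.ofReal_mul, Complex.ofReal_re]
    exact mul_nonneg (by positivity) (tsum_nonneg fun n => (Real.exp_pos _).le)
  rw [← hlhs, key]
  exact hrhs

/-- **The Villain model is dual-positive**: for all stiffnesses `β_μ > 0`, every dual bond factor
`ŵ_μ(θ) = ∑_n e^{-n²/(2β_μ)} cos(nθ)` of `villain β` is `≥ 0` (it is a periodised Gaussian).
[cite: WallinEtAl1994, §II] -/
theorem villain_isDualPositive (β : Dir d → ℝ) (hβ : ∀ μ, 0 < β μ) :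
    (villain β hβ).IsDualPositive :=
  fun μ θ => tsum_villainCurrentWeight_mul_cos_nonneg (hβ μ) θ

end PositiveCurrentModel

end Literature.Probability.LatticeModels
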